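import Mathlib
import HarnessLib
import Summits.NavierStokesRegularity.NavierStokesRegularity.Theorems.CompletionRelayChainPhaseISoundEncl
import Summits.NavierStokesRegularity.NavierStokesRegularity.Theorems.CompletionRelayChainDefs

/-!
# Route `CompletionRelayChain` — crux `RelayFrontStep` (stmt-NavierStokesRegularity-24850), K-side of `stub_phaseI`,
  work package K5-d: THE DISTURBANCE BOUND — along a pseudo-flow satisfying the hypotheses of `stub_phaseI`, the
  block velocity differs from the checker's field by at most the checker's `delta` (defect `κ₁4^k√F̄` with the
  energy bounds `fslack`/`fbar`, forcing radii from (W) and (T)), as long as the block has stayed in the a priori box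

The hypotheses of `stub_phaseI` are bundled in `Hyps`; the shell-2 energy bound (energy identity + Gronwall) enters as the
explicit hypothesis `Shell2Bound` (discharged separately).  MODEL-lattice bookkeeping (rung TL-M3-R64); nothing here is
a statement about the Navier–Stokes equations.
-/

noncomputable section

set_option linter.dupNamespace false

namespace Summit.NavierStokesRegularity.NavierStokesRegularity.Cruxes.RelayFrontStep.PhaseI

open Set Checker MeasureTheory
open Literature.Analysis.FluidPDE.TaoCascade

/-! ### The hypotheses of `stub_phaseI`, bundled -/

/-- The hypotheses of `stub_phaseI` (LINE `window_v2` v7) on a restarted pseudo-flow. [this file] -/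
structure Hyps (α : Fin 4 → Fin 4 → Fin 4 → ℤ × ℤ × ℤ → ℝ) (τ : ℝ) (S₀ F₀ B₀ : Fin 4 → ℤ → ℝ)
    (S F : Fin 4 → ℤ → ℝ → ℝ) : Prop where
  /-- table class -/
  hE : InTableClass 64 α
  /-- relay rows -/
  hrows : Window2.RelayRows α
  /-- `W₃` start -/
  hW : Window2.RelayWindow₃ S₀ F₀
  /-- slack nonnegative -/
  hB0 : ∀ i k, 0 ≤ B₀ i k
  /-- slack caps -/
  hBm3 : ∀ i, B₀ i (-3) ≤ 28 / 10 ^ 6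
  /-- slack caps -/
  hBm2 : ∀ i, B₀ i (-2) ≤ 14 / 10 ^ 6
  /-- slack caps -/
  hBm1 : ∀ i, B₀ i (-1) ≤ 7 / 10 ^ 6
  /-- slack caps -/
  hB00 : ∀ i, B₀ i 0 ≤ 35 / 10 ^ 7
  /-- slack caps -/
  hB1 : ∀ i, B₀ i 1 ≤ 18 / 10 ^ 7
  /-- slack caps -/
  hB2 : ∀ i, B₀ i 2 ≤ 9 / 10 ^ 7
  /-- horizon -/
  hτ : 8 ≤ τ
  /-- the pseudo-flow -/
  hflow : PseudoFlowOn τ 1 α (1 / 10 ^ 8) (1 / 10 ^ 8) S₀ F₀ B₀ S F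
  /-- (T) tail forcing -/
  hT : ∀ t ∈ Icc (0:ℝ) τ, t ≤ 8 → (∫ s in (0:ℝ)..t, S 1 2 s ^ 2) ≤ 1 / 10 ^ 11 →
    (∫ s in (0:ℝ)..t, |S 2 2 s * S 1 2 s|) ≤ 1 / 10 ^ 13 → ∀ s ∈ Icc (0:ℝ) t, ∑ i, F i 3 s ≤ 6 / 10 ^ 20
  /-- (W) wake forcing -/
  hW4 : ∀ s ∈ Icc (0:ℝ) τ, s ≤ 8 → ∑ i, F i (-4) s ≤ (1 + s / 20) * Window2.wakeS (-4)
  /-- (A) a priori bound -/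
  hA : ∀ s ∈ Icc (0:ℝ) τ, s ≤ 8 → ∀ k : ℤ, -3 ≤ k → ∑ i, F i k s ≤ 5 / 2

/-- The shell-`2` per-mode energy bound (energy identity + Gronwall; supplied separately): on `[0, 147/64]`,
`F_{i,2}(t) ≤ (F₀_{i,2} + ½M²)(1 + 2^{-18})` whenever `|S_{i,2}| ≤ M` on `[0,t]`. [this file] -/
def Shell2Bound (F₀ : Fin 4 → ℤ → ℝ) (S F : Fin 4 → ℤ → ℝ → ℝ) : Prop :=
  ∀ (i : Fin 3) (t : ℝ), 0 ≤ t → t ≤ 147 / 64 → ∀ M : ℝ, (∀ r ∈ Icc (0:ℝ) t, |S (blockMode i) 2 r| ≤ M) →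
    F (blockMode i) 2 t ≤ (F₀ (blockMode i) 2 + M ^ 2 / 2) * (1 + 1 / 2 ^ 18)

variable {α : Fin 4 → Fin 4 → Fin 4 → ℤ × ℤ × ℤ → ℝ} {τ : ℝ} {S₀ F₀ B₀ : Fin 4 → ℤ → ℝ} {S F : Fin 4 → ℤ → ℝ → ℝ}

/-! ### Small facts -/

/-- `blockMode i ≠ 3`. [this file] -/
theorem blockMode_ne_three (i : Fin 3) : blockMode i ≠ 3 := by
  fin_cases i <;> simp [blockMode]

/-- `slot (enc (s,i)) = s`. [this file] -/
theorem slot_enc (s : Fin 6) (i : Fin 3) : slot (enc (s, i)) = s.val := by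
  have := i.isLt; simp only [slot, enc]; omega

/-- `(1+1)^{2k} = fourPow` at `k = s − 3`. [this file] -/
theorem rpow_two_mul_eq_fourPow (s : Fin 6) (i : Fin 3) :
    (1 + 1 : ℝ) ^ ((2 : ℝ) * (((((s : ℕ) : ℤ) - 3 : ℤ)) : ℝ)) = ((fourPow (enc (s, i)) : ℚ) : ℝ) := by
  rw [fourPow, slot_enc]
  have h2 : (1 + 1 : ℝ) = 2 := by norm_num
  rw [h2, show (2 : ℝ) * (((((s : ℕ) : ℤ) - 3 : ℤ)) : ℝ) = (((2 * (s : ℕ) : ℕ) : ℤ) - 6 : ℤ) by push_cast; ring,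
    Real.rpow_intCast, zpow_sub₀ (by norm_num), zpow_natCast]
  push_cast
  rw [pow_mul]; norm_num

/-- The slack cap by slot. [this file] -/
theorem b0_le_b0max (H : Hyps α τ S₀ F₀ B₀ S F) (s : Fin 6) (i : Fin 3) :
    B₀ (blockMode i) (((s : ℕ) : ℤ) - 3) ≤ ((b0max (enc (s, i)) : ℚ) : ℝ) := by
  rw [b0max, slot_enc]
  fin_cases s
  · simpa using H.hBm3 (blockMode i)
  · simpa using H.hBm2 (blockMode i)
  · simpa using H.hBm1 (blockMode i)
  · simpa using H.hB00 (blockMode i)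
  · simpa using H.hB1 (blockMode i)
  · simpa using H.hB2 (blockMode i)

/-- `F_{i,k} ≤ Σ_j F_{j,k}`. [this file] -/
theorem F_le_sum (H : Hyps α τ S₀ F₀ B₀ S F) (i : Fin 4) (k : ℤ) {s : ℝ} (hs : s ∈ Icc (0:ℝ) τ) :
    F i k s ≤ ∑ j, F j k s :=
  Finset.single_le_sum (f := fun j => F j k s) (fun j _ => H.hflow.nonneg_F j k s hs) (Finset.mem_univ i)

/-- `∫₀ᵗ F_{i,k} ≤ (5/2)·t` for block shells on `[0, 8]`. [this file] -/
theorem integral_F_le (H : Hyps α τ S₀ F₀ B₀ S F) (i : Fin 4) {k : ℤ} (hk : -3 ≤ k) {t : ℝ} (ht0 : 0 ≤ t) (ht8 : t ≤ 8) :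
    (∫ u in (0:ℝ)..t, F i k u) ≤ 5 / 2 * t := by
  have htτ : t ≤ τ := ht8.trans H.hτ
  have hcont : ContinuousOn (F i k) (Icc 0 t) :=
    ((H.hflow.contDiffOn_F i k).continuousOn).mono (Icc_subset_Icc_right htτ)
  have hle : ∀ u ∈ Icc (0:ℝ) t, F i k u ≤ 5 / 2 := fun u hu =>
    (F_le_sum H i k ⟨hu.1, hu.2.trans htτ⟩).trans (H.hA u ⟨hu.1, hu.2.trans htτ⟩ (hu.2.trans ht8) k hk)
  calc (∫ u in (0:ℝ)..t, F i k u) ≤ ∫ _ in (0:ℝ)..t, (5 / 2 : ℝ) := by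
        refine intervalIntegral.integral_mono_on ht0 (hcont.intervalIntegrable_of_Icc ht0)
          (by simp) fun u hu => hle u hu
    _ = 5 / 2 * t := by simp; ring

/-! ### Energy bounds -/

/-- **Slack-form energy bound**: `F_{i,k}(t) ≤ fslack m` when `|S_{i,k}(t)| ≤ m`, `t ≤ T*`. [this file] -/
theorem energy_le_fslack (H : Hyps α τ S₀ F₀ B₀ S F) (s : Fin 6) (i : Fin 3) {t : ℝ} (ht0 : 0 ≤ t)
    (htT : t ≤ 147 / 64) {m : ℚ} (hm : |S (blockMode i) (((s : ℕ) : ℤ) - 3) t| ≤ (m : ℝ)) :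
    F (blockMode i) (((s : ℕ) : ℤ) - 3) t ≤ ((fslack m (enc (s, i)) : ℚ) : ℝ) := by
  have ht8 : t ≤ 8 := htT.trans (by norm_num)
  have htτ : t ∈ Icc (0:ℝ) τ := ⟨ht0, ht8.trans H.hτ⟩
  have hdu := H.hflow.defect_upper (blockMode i) (((s : ℕ) : ℤ) - 3) t htτ
  rw [rpow_two_mul_eq_fourPow s i] at hdu
  have hint := integral_F_le H (blockMode i) (k := ((s : ℕ) : ℤ) - 3) (by omega) ht0 ht8
  have hb0 := b0_le_b0max H s i
  have hsq : S (blockMode i) (((s : ℕ) : ℤ) - 3) t ^ 2 ≤ (m : ℝ) * m := by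
    have h0 : 0 ≤ (m : ℝ) := (abs_nonneg _).trans hm
    calc S (blockMode i) (((s : ℕ) : ℤ) - 3) t ^ 2 = |S (blockMode i) (((s : ℕ) : ℤ) - 3) t| ^ 2 := (sq_abs _).symm
      _ ≤ (m : ℝ) ^ 2 := pow_le_pow_left₀ (abs_nonneg _) hm 2
      _ = (m : ℝ) * m := sq _
  have hfp : (0 : ℝ) ≤ ((fourPow (enc (s, i)) : ℚ) : ℝ) := by
    rw [fourPow]; push_cast; positivity
  simp only [fslack, Checker.kappa, Checker.Tstar]
  push_cast
  set II : ℝ := ∫ u in (0:ℝ)..t, F (blockMode i) (((s : ℕ) : ℤ) - 3) u with hII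
  have hII' : II ≤ 147 / 64 * (5 / 2) := by linarith
  have h4 : (1 / 10 ^ 8 : ℝ) * ((fourPow (enc (s, i)) : ℚ) : ℝ) * II ≤
      (1 / 10 ^ 8 : ℝ) * ((fourPow (enc (s, i)) : ℚ) : ℝ) * (147 / 64) * (5 / 2) := by
    have := mul_le_mul_of_nonneg_left hII' (show (0:ℝ) ≤ (1 / 10 ^ 8 : ℝ) * ((fourPow (enc (s, i)) : ℚ) : ℝ) by
      positivity)
    linarith
  linarith

/-- `aheadE 2 = aheadE2`. [this file] -/
theorem aheadE_two : Window2.aheadE 2 = ((aheadE2 : ℚ) : ℝ) := by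
  simp only [Window2.aheadE, aheadE2]
  push_cast
  norm_num

/-- **Start-cap energy bound for old shell `2`**: `F_{i,2}(t) ≤ fbar` given the running maximum. [this file] -/
theorem energy_le_fbar_shell2 (H : Hyps α τ S₀ F₀ B₀ S F) (h2 : Shell2Bound F₀ S F) (i : Fin 3) {t : ℝ}
    (ht0 : 0 ≤ t) (htT : t ≤ 147 / 64) {B : V19 IV} {emax : V19 ℚ}
    (hhist : ∀ r ∈ Icc (0:ℝ) t, |S (blockMode i) 2 r| ≤ max (((B[enc (5, i)]).mag : ℚ) : ℝ) ((emax[enc (5, i)] : ℚ) : ℝ)) :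
    F (blockMode i) 2 t ≤ ((fbar B emax (enc (5, i)) : ℚ) : ℝ) := by
  have hF0 : F₀ (blockMode i) 2 ≤ ((aheadE2 : ℚ) : ℝ) := by
    rw [← aheadE_two]
    exact H.hW.2.2.2.2.2.2.2.2.2.2.1 2 le_rfl (blockMode i) (blockMode_ne_three i)
  have key := h2 i t ht0 htT _ hhist
  have hslot : ¬ slot (enc (5, i)) ≤ 4 := by rw [slot_enc]; decide
  simp only [fbar, hslot, if_false]
  push_cast
  set M : ℝ := max (((B[enc (5, i)]).mag : ℚ) : ℝ) ((emax[enc (5, i)] : ℚ) : ℝ)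
  have hM : (0:ℝ) ≤ 1 + 1 / 2 ^ 18 := by norm_num
  calc F (blockMode i) 2 t ≤ (F₀ (blockMode i) 2 + M ^ 2 / 2) * (1 + 1 / 2 ^ 18) := key
    _ ≤ (((aheadE2 : ℚ) : ℝ) + M * M / 2) * (1 + 1 / 2 ^ 18) := by
        refine mul_le_mul_of_nonneg_right ?_ hM
        rw [sq]; linarith

/-- **`F ≤ F̄` on every block component** (`t = a + σ ≤ T*`, the block in the box at time `t`, and for shell 2 the
running maximum over `[0,t]`). [this file] -/
theorem energy_le_fbar (H : Hyps α τ S₀ F₀ B₀ S F) (h2 : Shell2Bound F₀ S F) (s : Fin 6) (i : Fin 3) {t : ℝ}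
    (ht0 : 0 ≤ t) (htT : t ≤ 147 / 64) {B : V19 IV} {emax : V19 ℚ}
    (hnow : |S (blockMode i) (((s : ℕ) : ℤ) - 3) t| ≤ (((B[enc (s, i)]).mag : ℚ) : ℝ))
    (hhist : s.val = 5 → ∀ r ∈ Icc (0:ℝ) t, |S (blockMode i) 2 r| ≤
      max (((B[enc (s, i)]).mag : ℚ) : ℝ) ((emax[enc (s, i)] : ℚ) : ℝ)) :
    F (blockMode i) (((s : ℕ) : ℤ) - 3) t ≤ ((fbar B emax (enc (s, i)) : ℚ) : ℝ) := by
  by_cases hs : slot (enc (s, i)) ≤ 4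
  · have : fbar B emax (enc (s, i)) = fslack (B[enc (s, i)]).mag (enc (s, i)) := by
      simp only [fbar, hs, if_true, fslack]
    rw [this]
    exact energy_le_fslack H s i ht0 htT hnow
  · have hs5 : s.val = 5 := by rw [slot_enc] at hs; have := s.isLt; omega
    have hs' : s = (5 : Fin 6) := Fin.ext hs5
    subst hs'
    have := energy_le_fbar_shell2 H h2 i ht0 htT (B := B) (emax := emax) (hhist rfl)
    simpa using this

/-! ### Forcing bounds -/

/-- `wakeS (-4) = 2`. [this file] -/
theorem wakeS_neg_four : Window2.wakeS (-4) = 2 := by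
  simp only [Window2.wakeS]
  rw [show (-((-4 : ℤ) : ℝ)) = ((4 : ℕ) : ℝ) by norm_num, Real.rpow_natCast]; norm_num

/-- Amplitude bound from a shell-energy bound: `|S_{i,k}|² ≤ 2 Σ_j F_{j,k}`. [this file] -/
theorem sq_le_two_sum (H : Hyps α τ S₀ F₀ B₀ S F) (i : Fin 4) (k : ℤ) {s : ℝ} (hs : s ∈ Icc (0:ℝ) τ) :
    S i k s ^ 2 ≤ 2 * ∑ j, F j k s := by
  have h1 := H.hflow.defect_lower i k s hs
  have h2 := F_le_sum H i k hs
  linarith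

/-- The shell-`(−4)` forcing of `ẋ₋₃` lies in `[0, 2·FR0]` on `[0, T*]`. [this file] -/
theorem forcing_x3 (H : Hyps α τ S₀ F₀ B₀ S F) {t : ℝ} (ht0 : 0 ≤ t) (htT : t ≤ 147 / 64) :
    0 ≤ blockForcing S t ((0 : Fin 6), (0 : Fin 3)) ∧
      blockForcing S t ((0 : Fin 6), (0 : Fin 3)) ≤ 2 * ((FR0 : ℚ) : ℝ) := by
  have ht8 : t ≤ 8 := htT.trans (by norm_num)
  have htτ : t ∈ Icc (0:ℝ) τ := ⟨ht0, ht8.trans H.hτ⟩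
  have hw := H.hW4 t htτ ht8
  rw [wakeS_neg_four] at hw
  have hsq := sq_le_two_sum H 1 (-4) htτ
  simp only [blockForcing, if_true, lam_neg_four]
  constructor
  · exact mul_nonneg (by norm_num) (mul_self_nonneg _)
  · simp only [FR0, Checker.Tstar]; push_cast
    nlinarith

/-- The shell-`(−4)` forcing of `u̇₋₃` is at most `FR1` on `[0, T*]`. [this file] -/
theorem forcing_u3 (H : Hyps α τ S₀ F₀ B₀ S F) {t : ℝ} (ht0 : 0 ≤ t) (htT : t ≤ 147 / 64) :
    |blockForcing S t ((0 : Fin 6), (1 : Fin 3))| ≤ ((FR1 : ℚ) : ℝ) := by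
  have ht8 : t ≤ 8 := htT.trans (by norm_num)
  have htτ : t ∈ Icc (0:ℝ) τ := ⟨ht0, ht8.trans H.hτ⟩
  have hw := H.hW4 t htτ ht8
  rw [wakeS_neg_four] at hw
  have h1 := H.hflow.defect_lower 1 (-4) t htτ
  have h2 := H.hflow.defect_lower 2 (-4) t htτ
  have hsum : F 1 (-4) t + F 2 (-4) t ≤ ∑ j, F j (-4) t := by
    rw [Fin.sum_univ_four]
    linarith [H.hflow.nonneg_F 0 (-4) t htτ, H.hflow.nonneg_F 3 (-4) t htτ]
  have hne : ((0 : Fin 6), (1 : Fin 3)) ≠ ((0 : Fin 6), (0 : Fin 3)) := by decide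
  simp only [blockForcing, hne, if_false, if_true, lam_neg_four]
  rw [abs_le]
  simp only [FR1, Checker.Tstar]; push_cast
  have hprod : |S 2 (-4) t * S 1 (-4) t| ≤ F 1 (-4) t + F 2 (-4) t := by
    rw [abs_mul]
    nlinarith [sq_abs (S 2 (-4) t), sq_abs (S 1 (-4) t), abs_nonneg (S 2 (-4) t), abs_nonneg (S 1 (-4) t),
      sq_nonneg (|S 2 (-4) t| - |S 1 (-4) t|)]
  have := abs_le.1 hprod
  constructor <;> nlinarith [this.1, this.2]

/-- Old shell `3` amplitudes under (T): `|S_{i,3}(t)| ≤ X3` (`i = 0, 1`). [this file] -/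
theorem shell3_abs_le (H : Hyps α τ S₀ F₀ B₀ S F) {t : ℝ} (ht0 : 0 ≤ t) (htT : t ≤ 147 / 64)
    (hI1 : (∫ s in (0:ℝ)..t, S 1 2 s ^ 2) ≤ 1 / 10 ^ 11) (hI2 : (∫ s in (0:ℝ)..t, |S 2 2 s * S 1 2 s|) ≤ 1 / 10 ^ 13)
    (i : Fin 4) : |S i 3 t| ≤ ((X3 : ℚ) : ℝ) := by
  have ht8 : t ≤ 8 := htT.trans (by norm_num)
  have htτ : t ∈ Icc (0:ℝ) τ := ⟨ht0, ht8.trans H.hτ⟩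
  have h3 := H.hT t htτ ht8 hI1 hI2 t ⟨ht0, le_rfl⟩
  have hsq := sq_le_two_sum H i 3 htτ
  have hx : S i 3 t ^ 2 ≤ ((2 * 6 / 10 ^ 20 : ℚ) : ℝ) := by push_cast; linarith
  calc |S i 3 t| = Real.sqrt (S i 3 t ^ 2) := (Real.sqrt_sq_eq_abs _).symm
    _ ≤ Real.sqrt (((2 * 6 / 10 ^ 20 : ℚ) : ℝ)) := Real.sqrt_le_sqrt hx
    _ ≤ ((X3 : ℚ) : ℝ) := sqrt_le_sqrtUp (by norm_num)

end Summit.NavierStokesRegularity.NavierStokesRegularity.Cruxes.RelayFrontStep.PhaseI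

end
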